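import Mathlib
import Literature.MathematicalPhysics.StatisticalMechanics.LennardJonesClusters
import Summits.AtomisticToContinuum.Crystallization.Theorems.ChartedPlanarOrderEnvelopeShell
import Summits.AtomisticToContinuum.Crystallization.Theorems.ChartedPlanarOrderDefectEventGeometry

/-!
# Envelope transport for `ChartedZeroExcessLayered` — part 2/4: Lennard-Jones sums on separated sets; finite-sum forms of the walk

Uniform bounds `∑_{q ∈ S} |V_LJ(dist p q)| ≤ ljBound δ` on `δ`-separated sets (shell counting), integrability of
`|V_LJ ‖·‖|` against `count|S`, and the identification of the REAL bond-walk operator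
`(W_μ f)(x) = (1/12) ∫ 𝟙{0 < dist x y ≤ 28/25} f y ∂μ` with the `ℝ≥0∞` kernel walk of the landed transport engine on counting
measures (`walk_enn_eq_ofReal_walk_real`).  Part of the proof of stub `stub_walkTransportEnvS` (stmt-AtomisticToContinuum-26636).
-/

set_option maxHeartbeats 800000

namespace Summit.AtomisticToContinuum.Crystallization.Theorems.ChartedPlanarOrderEnvelopeTransport

open MeasureTheory Literature.Geometry.DiscreteGeometry Literature.Probability.Process
open Literature.MathematicalPhysics.StatisticalMechanics
open Summit.AtomisticToContinuum.Crystallization.Theorems.ChartedPlanarOrderBondWalkTransport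
open Summit.AtomisticToContinuum.Crystallization.Theorems.ChartedPlanarOrderPatternWalkHyps
open scoped ENNReal
open Summit.AtomisticToContinuum.Crystallization.Theorems.ChartedPlanarOrderDefectEventGeometry

/-! ## Stage 1 — uniform Lennard-Jones bounds on separated sets -/

/-- `|V_LJ(t)| ≤ δ⁻¹²/12 + δ⁻⁶/6` for `t ≥ δ > 0`. -/
theorem abs_lennardJones_le_of_ge {δ t : ℝ} (hδ : 0 < δ) (ht : δ ≤ t) :
    |lennardJones t| ≤ (1 / 12) * δ⁻¹ ^ 12 + (1 / 6) * δ⁻¹ ^ 6 := by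
  have ht0 : 0 < t := hδ.trans_le ht
  have h1 : t⁻¹ ≤ δ⁻¹ := (inv_le_inv₀ ht0 hδ).2 ht
  have h0 : 0 ≤ t⁻¹ := inv_nonneg.2 ht0.le
  have h12 : t⁻¹ ^ 12 ≤ δ⁻¹ ^ 12 := pow_le_pow_left₀ h0 h1 12
  have h6 : t⁻¹ ^ 6 ≤ δ⁻¹ ^ 6 := pow_le_pow_left₀ h0 h1 6
  have hp12 : 0 ≤ t⁻¹ ^ 12 := pow_nonneg h0 12
  have hp6 : 0 ≤ t⁻¹ ^ 6 := pow_nonneg h0 6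
  have : lennardJones t = (1 / 12) * (t⁻¹) ^ 12 - (1 / 6) * (t⁻¹) ^ 6 := rfl
  rw [this, abs_le]
  constructor <;> nlinarith

/-- the separated-sum bound `ljBound δ` is nonnegative. -/
theorem ljBound_nonneg {δ : ℝ} (hδ : 0 < δ) : 0 ≤ ljBound δ := by
  unfold ljBound; positivity

/-- **Uniform Lennard-Jones bound on separated sets** (finite partial sums): for `S` `δ`-separated, `x ∈ S` and
`T ⊆ S` finite, `∑_{y ∈ T} |V_LJ(dist x y)| ≤ M(δ)` (packing count in the unit ball + `r⁻⁶` shell sum outside). -/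
theorem sum_abs_lennardJones_le {S : Set (EuclideanSpace ℝ (Fin 3))} {δ : ℝ} (hδ : 0 < δ)
    (hsep : ∀ x ∈ S, ∀ y ∈ S, x ≠ y → δ ≤ dist x y) {x : EuclideanSpace ℝ (Fin 3)} (hx : x ∈ S)
    (T : Finset (EuclideanSpace ℝ (Fin 3))) (hT : ∀ y ∈ T, y ∈ S) :
    ∑ y ∈ T, |lennardJones (dist x y)| ≤ ljBound δ := by
  classical
  set L : ℝ := (1 / 12) * δ⁻¹ ^ 12 + (1 / 6) * δ⁻¹ ^ 6 with hL
  have hL0 : 0 ≤ L := by rw [hL]; positivity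
  set η : ℝ := min δ 1 with hη
  have hη0 : 0 < η := lt_min hδ one_pos
  have hηδ : η ≤ δ := min_le_left _ _
  have hη1 : η ≤ 1 := min_le_right _ _
  set T₁ := T.filter (fun y => dist x y < 1) with hT₁
  set T₂ := T.filter (fun y => ¬ dist x y < 1) with hT₂
  have hsplit : ∑ y ∈ T, |lennardJones (dist x y)|
      = ∑ y ∈ T₁, |lennardJones (dist x y)| + ∑ y ∈ T₂, |lennardJones (dist x y)| :=
    (Finset.sum_filter_add_sum_filter_not T (fun y => dist x y < 1) _).symm
  -- near part
  have hnear_term : ∀ y ∈ T₁, |lennardJones (dist x y)| ≤ L := by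
    intro y hy
    have hyS : y ∈ S := hT y (Finset.mem_filter.1 hy).1
    by_cases hxy : x = y
    · subst hxy; rw [dist_self, lennardJones_zero, abs_zero]; exact hL0
    · exact abs_lennardJones_le_of_ge hδ (hsep x hx y hyS hxy)
  have hnear_sum : ∑ y ∈ T₁, |lennardJones (dist x y)| ≤ T₁.card * L := by
    have := Finset.sum_le_card_nsmul T₁ (fun y => |lennardJones (dist x y)|) L hnear_term
    simpa [nsmul_eq_mul] using this
  have hcard : (T₁.card : ℝ) ≤ (2 * 1 / δ + 1) ^ 3 := by
    have h := card_le_of_separated_of_dist_le T₁ x hδ zero_le_one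
      (fun c hc => by
        have := (Finset.mem_filter.1 hc).2
        rw [dist_comm] at this; exact this.le)
      (fun c hc d hd hcd => hsep c (hT c (Finset.mem_filter.1 hc).1) d (hT d (Finset.mem_filter.1 hd).1) hcd)
    simpa [finrank_euclideanSpace_fin] using h
  have hnear : ∑ y ∈ T₁, |lennardJones (dist x y)| ≤ (2 * 1 / δ + 1) ^ 3 * L :=
    hnear_sum.trans (mul_le_mul_of_nonneg_right hcard hL0)
  -- far part
  have hfar_term : ∀ y ∈ T₂, |lennardJones (dist x y)| ≤ 1 / 4 * (dist x y)⁻¹ ^ 6 := by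
    intro y hy
    have h1 : 1 ≤ dist x y := not_lt.1 (Finset.mem_filter.1 hy).2
    exact abs_lennardJones_le h1
  have hfar6 : ∑ y ∈ T₂, (dist x y)⁻¹ ^ 6 ≤ 250 * η⁻¹ ^ 6 :=
    sum_inv_pow_six_le_of_le_dist T₂ x hη0
      (fun z hz => hη1.trans (not_lt.1 (Finset.mem_filter.1 hz).2))
      (fun z hz w hw hzw => hηδ.trans
        (hsep z (hT z (Finset.mem_filter.1 hz).1) w (hT w (Finset.mem_filter.1 hw).1) hzw))
  have hfar : ∑ y ∈ T₂, |lennardJones (dist x y)| ≤ 1 / 4 * (250 * η⁻¹ ^ 6) := by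
    calc ∑ y ∈ T₂, |lennardJones (dist x y)| ≤ ∑ y ∈ T₂, 1 / 4 * (dist x y)⁻¹ ^ 6 :=
          Finset.sum_le_sum hfar_term
      _ = 1 / 4 * ∑ y ∈ T₂, (dist x y)⁻¹ ^ 6 := by rw [Finset.mul_sum]
      _ ≤ 1 / 4 * (250 * η⁻¹ ^ 6) := by
          exact mul_le_mul_of_nonneg_left hfar6 (by norm_num)
  rw [hsplit]
  unfold ljBound
  rw [← hη, ← hL]
  linarith

/-- A `δ`-separated subset of `ℝ³` is countable. -/
theorem countable_of_separated {S : Set (EuclideanSpace ℝ (Fin 3))} {δ : ℝ} (hδ : 0 < δ)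
    (hsep : ∀ x ∈ S, ∀ y ∈ S, x ≠ y → δ ≤ dist x y) : S.Countable := by
  have hS : S = ⋃ n : ℕ, (Metric.closedBall (0 : EuclideanSpace ℝ (Fin 3)) n ∩ S) := by
    ext y; simp only [Set.mem_iUnion, Set.mem_inter_iff, Metric.mem_closedBall]
    constructor
    · intro hy; obtain ⟨n, hn⟩ := exists_nat_ge (dist y 0); exact ⟨n, hn, hy⟩
    · rintro ⟨n, -, hy⟩; exact hy
  rw [hS]
  exact Set.countable_iUnion fun n =>
    (Literature.Probability.Process.LocalConfig.finite_inter_of_separated hδ hsep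
      (isCompact_closedBall _ _)).countable

/-- Finite partial sums of an `S`-indicator against counting measure: `∫⁻ in S` as a supremum bound. -/
theorem lintegral_count_restrict_le_of_sum_le {S : Set (EuclideanSpace ℝ (Fin 3))} (hS : MeasurableSet S)
    {f : EuclideanSpace ℝ (Fin 3) → ℝ≥0∞} {c : ℝ≥0∞}
    (h : ∀ T : Finset (EuclideanSpace ℝ (Fin 3)), (∀ y ∈ T, y ∈ S) → ∑ y ∈ T, f y ≤ c) :
    ∫⁻ y, f y ∂((Measure.count : Measure (EuclideanSpace ℝ (Fin 3))).restrict S) ≤ c := by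
  classical
  rw [← lintegral_indicator hS, lintegral_count]
  refine ENNReal.summable.tsum_le_of_sum_le fun T => ?_
  have : ∑ y ∈ T, S.indicator f y = ∑ y ∈ T.filter (fun y => y ∈ S), f y := by
    rw [Finset.sum_filter]
    refine Finset.sum_congr rfl fun y _ => ?_
    by_cases hy : y ∈ S
    · simp [hy]
    · simp [hy]
  rw [this]
  exact h _ fun y hy => (Finset.mem_filter.1 hy).2

/-- **Uniform bound, `lintegral` form:** `∫⁻_{S} |V_LJ(dist x ·)| d(count) ≤ M(δ)` at every `x ∈ S`. -/
theorem lintegral_abs_lennardJones_le {S : Set (EuclideanSpace ℝ (Fin 3))} {δ : ℝ} (hδ : 0 < δ)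
    (hsep : ∀ x ∈ S, ∀ y ∈ S, x ≠ y → δ ≤ dist x y) {x : EuclideanSpace ℝ (Fin 3)} (hx : x ∈ S) :
    ∫⁻ y, ENNReal.ofReal |lennardJones (dist x y)|
        ∂((Measure.count : Measure (EuclideanSpace ℝ (Fin 3))).restrict S)
      ≤ ENNReal.ofReal (ljBound δ) := by
  refine lintegral_count_restrict_le_of_sum_le (countable_of_separated hδ hsep).measurableSet
    fun T hT => ?_
  rw [← ENNReal.ofReal_sum_of_nonneg (fun y _ => abs_nonneg _)]
  exact ENNReal.ofReal_le_ofReal (sum_abs_lennardJones_le hδ hsep hx T hT)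


/-! ## Stage 2 — finite-sum forms of both walk operators and the real ↔ ℝ≥0∞ identification -/

/-- Real walk window integral against `count|S` = finite sum over `closedBall x (28/25) ∩ S` (copy of
`WindowDuality.walk_integral_eq_sum`). -/
theorem walk_integral_eq_sum' {S : Set (EuclideanSpace ℝ (Fin 3))} (f : EuclideanSpace ℝ (Fin 3) → ℝ)
    (x : EuclideanSpace ℝ (Fin 3)) (F : Finset (EuclideanSpace ℝ (Fin 3)))
    (hFF : (↑F : Set (EuclideanSpace ℝ (Fin 3))) = Metric.closedBall x (28 / 25) ∩ S) :
    ∫ y, (if 0 < dist x y ∧ dist x y ≤ 28 / 25 then f y else 0)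
        ∂((MeasureTheory.Measure.count : MeasureTheory.Measure (EuclideanSpace ℝ (Fin 3))).restrict S)
      = ∑ y ∈ F, (if 0 < dist x y ∧ dist x y ≤ 28 / 25 then f y else 0) := by
  classical
  set g : EuclideanSpace ℝ (Fin 3) → ℝ := fun y => if 0 < dist x y ∧ dist x y ≤ 28 / 25 then f y else 0 with hg
  have h1 : ∫ y, g y ∂((Measure.count : Measure (EuclideanSpace ℝ (Fin 3))).restrict S)
      = ∫ y in Metric.closedBall x (28 / 25), g y ∂((Measure.count : Measure (EuclideanSpace ℝ (Fin 3))).restrict S) := by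
    refine (setIntegral_eq_integral_of_forall_compl_eq_zero (fun y hy => ?_)).symm
    have hny : ¬ (0 < dist x y ∧ dist x y ≤ 28 / 25) := fun h =>
      hy (Metric.mem_closedBall.2 (by rw [dist_comm]; exact h.2))
    simp only [hg, hny, if_false]
  have hFset : (↑F : Set (EuclideanSpace ℝ (Fin 3))) = ⋃ i ∈ F, ({i} : Set (EuclideanSpace ℝ (Fin 3))) := by
    ext z; simp
  have hint : IntegrableOn g (↑F) (Measure.count : Measure (EuclideanSpace ℝ (Fin 3))) := by
    rw [hFset, integrableOn_finset_iUnion]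
    intro y _
    exact integrableOn_singleton (by simp) (by rw [Measure.count_singleton]; exact ENNReal.one_lt_top)
  rw [h1, Measure.restrict_restrict measurableSet_closedBall, ← hFF, setIntegral_finset _ hint]
  refine Finset.sum_congr rfl (fun y _ => ?_)
  rw [measureReal_def, Measure.count_singleton, ENNReal.toReal_one, one_smul]

/-- membership in the bond shell `{y | 0 < dist x y ≤ 28/25}`. -/
theorem mem_shellPre_iff (x y : EuclideanSpace ℝ (Fin 3)) :
    y ∈ (fun y => y - x) ⁻¹' {v : EuclideanSpace ℝ (Fin 3) | 0 < dist (0 : EuclideanSpace ℝ (Fin 3)) v ∧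
        dist (0 : EuclideanSpace ℝ (Fin 3)) v ≤ 28 / 25}
      ↔ (0 < dist x y ∧ dist x y ≤ 28 / 25) := by
  have : dist (0 : EuclideanSpace ℝ (Fin 3)) (y - x) = dist x y := by
    rw [dist_eq_norm, dist_eq_norm, zero_sub, norm_neg, norm_sub_rev]
  simp only [Set.mem_preimage, Set.mem_setOf_eq, this]

/-- `ℝ≥0∞` walk window integral against `count|S` = finite sum over `closedBall x (28/25) ∩ S`. -/
theorem walk_lintegral_eq_sum {S : Set (EuclideanSpace ℝ (Fin 3))} (hS : MeasurableSet S)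
    (h : EuclideanSpace ℝ (Fin 3) → ℝ≥0∞)
    (x : EuclideanSpace ℝ (Fin 3)) (F : Finset (EuclideanSpace ℝ (Fin 3)))
    (hFF : (↑F : Set (EuclideanSpace ℝ (Fin 3))) = Metric.closedBall x (28 / 25) ∩ S) :
    ∫⁻ y, ((fun y => y - x) ⁻¹' {v : EuclideanSpace ℝ (Fin 3) | 0 < dist (0 : EuclideanSpace ℝ (Fin 3)) v ∧
        dist (0 : EuclideanSpace ℝ (Fin 3)) v ≤ 28 / 25}).indicator h y
        ∂((MeasureTheory.Measure.count : MeasureTheory.Measure (EuclideanSpace ℝ (Fin 3))).restrict S)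
      = ∑ y ∈ F, (if 0 < dist x y ∧ dist x y ≤ 28 / 25 then h y else 0) := by
  classical
  rw [← lintegral_indicator hS, lintegral_count]
  have hzero : ∀ y ∉ F, S.indicator (((fun y => y - x) ⁻¹' {v : EuclideanSpace ℝ (Fin 3) |
      0 < dist (0 : EuclideanSpace ℝ (Fin 3)) v ∧ dist (0 : EuclideanSpace ℝ (Fin 3)) v ≤ 28 / 25}).indicator h) y = 0 := by
    intro y hy
    by_cases hyS : y ∈ S
    · rw [Set.indicator_of_mem hyS]
      have hw : y ∉ (fun y => y - x) ⁻¹' {v : EuclideanSpace ℝ (Fin 3) |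
          0 < dist (0 : EuclideanSpace ℝ (Fin 3)) v ∧ dist (0 : EuclideanSpace ℝ (Fin 3)) v ≤ 28 / 25} := by
        intro hw
        have hw' := (mem_shellPre_iff x y).1 hw
        apply hy
        have : y ∈ (↑F : Set (EuclideanSpace ℝ (Fin 3))) := by
          rw [hFF]; exact ⟨Metric.mem_closedBall.2 (by rw [dist_comm]; exact hw'.2), hyS⟩
        exact this
      exact Set.indicator_of_notMem hw _
    · exact Set.indicator_of_notMem hyS _
  rw [tsum_eq_sum (s := F) (fun y hy => hzero y hy)]
  refine Finset.sum_congr rfl (fun y hy => ?_)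
  have hyS : y ∈ S := by
    have : y ∈ (↑F : Set (EuclideanSpace ℝ (Fin 3))) := hy
    rw [hFF] at this; exact this.2
  rw [Set.indicator_of_mem hyS, Set.indicator_apply]
  by_cases hw : 0 < dist x y ∧ dist x y ≤ 28 / 25
  · rw [if_pos ((mem_shellPre_iff x y).2 hw), if_pos hw]
  · rw [if_neg (fun h' => hw ((mem_shellPre_iff x y).1 h')), if_neg hw]

/-- Number of `S`-points in the bond window of `x`, read off the counting measure. -/
theorem card_filter_window_eq {S : Set (EuclideanSpace ℝ (Fin 3))} (hS : MeasurableSet S)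
    (x : EuclideanSpace ℝ (Fin 3)) (F : Finset (EuclideanSpace ℝ (Fin 3)))
    (hFF : (↑F : Set (EuclideanSpace ℝ (Fin 3))) = Metric.closedBall x (28 / 25) ∩ S) {k : ℕ}
    (hk : ((MeasureTheory.Measure.count : MeasureTheory.Measure (EuclideanSpace ℝ (Fin 3))).restrict S)
      {y | 0 < dist x y ∧ dist x y ≤ 28 / 25} = k) :
    (F.filter (fun y => 0 < dist x y ∧ dist x y ≤ 28 / 25)).card = k := by
  classical
  have hset : {y : EuclideanSpace ℝ (Fin 3) | 0 < dist x y ∧ dist x y ≤ 28 / 25} ∩ S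
      = ↑(F.filter (fun y => 0 < dist x y ∧ dist x y ≤ 28 / 25)) := by
    ext y
    simp only [Set.mem_inter_iff, Set.mem_setOf_eq, Finset.coe_filter]
    constructor
    · rintro ⟨hw, hyS⟩
      refine ⟨?_, hw⟩
      have : y ∈ (↑F : Set (EuclideanSpace ℝ (Fin 3))) := by
        rw [hFF]; exact ⟨Metric.mem_closedBall.2 (by rw [dist_comm]; exact hw.2), hyS⟩
      exact this
    · rintro ⟨hyF, hw⟩
      have : y ∈ (↑F : Set (EuclideanSpace ℝ (Fin 3))) := hyF
      rw [hFF] at this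
      exact ⟨hw, this.2⟩
  rw [Measure.restrict_apply' hS, hset, Measure.count_apply_finset] at hk
  exact_mod_cast hk

/-- **Identification of the registered REAL walk with the engine's `ℝ≥0∞` walk** on `count|S` when every point of `S`
has exactly twelve `S`-points in its bond window: for `|f| ≤ M` on `S` and `g = ofReal (f + M)` on `S`,
`W_enn^n g x = ofReal (W_real^n f x + M)` and `|W_real^n f x| ≤ M` at every `x ∈ S`. -/
theorem walk_enn_eq_ofReal_walk_real {S : Set (EuclideanSpace ℝ (Fin 3))} (hS : MeasurableSet S)
    (hfin : ∀ x : EuclideanSpace ℝ (Fin 3), (Metric.closedBall x (28 / 25) ∩ S).Finite)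
    (h12 : ∀ q ∈ S, ((MeasureTheory.Measure.count : MeasureTheory.Measure (EuclideanSpace ℝ (Fin 3))).restrict S)
      {y | 0 < dist q y ∧ dist q y ≤ 28 / 25} = 12)
    (f : EuclideanSpace ℝ (Fin 3) → ℝ) (M : ℝ) (hfM : ∀ y ∈ S, |f y| ≤ M)
    (g : EuclideanSpace ℝ (Fin 3) → ℝ≥0∞) (hg : ∀ y ∈ S, g y = ENNReal.ofReal (f y + M)) :
    ∀ (n : ℕ) (x : EuclideanSpace ℝ (Fin 3)), x ∈ S →
      ((fun (h : EuclideanSpace ℝ (Fin 3) → ℝ≥0∞) (x : EuclideanSpace ℝ (Fin 3)) =>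
          (12 : ℝ≥0∞)⁻¹ * ∫⁻ y, ((fun y => y - x) ⁻¹'
            {v : EuclideanSpace ℝ (Fin 3) | 0 < dist (0 : EuclideanSpace ℝ (Fin 3)) v ∧
              dist (0 : EuclideanSpace ℝ (Fin 3)) v ≤ 28 / 25}).indicator h y
            ∂((MeasureTheory.Measure.count : MeasureTheory.Measure (EuclideanSpace ℝ (Fin 3))).restrict S))^[n] g) x
        = ENNReal.ofReal (((fun f : EuclideanSpace ℝ (Fin 3) → ℝ => fun x : EuclideanSpace ℝ (Fin 3) =>
            (1 / 12 : ℝ) * ∫ y, (if 0 < dist x y ∧ dist x y ≤ 28 / 25 then f y else 0)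
              ∂((MeasureTheory.Measure.count : MeasureTheory.Measure (EuclideanSpace ℝ (Fin 3))).restrict S))^[n] f) x + M)
      ∧ |((fun f : EuclideanSpace ℝ (Fin 3) → ℝ => fun x : EuclideanSpace ℝ (Fin 3) =>
            (1 / 12 : ℝ) * ∫ y, (if 0 < dist x y ∧ dist x y ≤ 28 / 25 then f y else 0)
              ∂((MeasureTheory.Measure.count : MeasureTheory.Measure (EuclideanSpace ℝ (Fin 3))).restrict S))^[n] f) x| ≤ M := by
  classical
  intro n
  induction n with
  | zero =>
    intro x hx
    simp only [Function.iterate_zero, id_eq]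
    exact ⟨hg x hx, hfM x hx⟩
  | succ n ih =>
    intro x hx
    obtain ⟨F, hFF⟩ : ∃ F : Finset (EuclideanSpace ℝ (Fin 3)),
        (↑F : Set (EuclideanSpace ℝ (Fin 3))) = Metric.closedBall x (28 / 25) ∩ S :=
      ⟨(hfin x).toFinset, (hfin x).coe_toFinset⟩
    have hFS : ∀ y ∈ F, y ∈ S := fun y hy => by
      have : y ∈ (↑F : Set (EuclideanSpace ℝ (Fin 3))) := hy
      rw [hFF] at this; exact this.2
    have hcard := card_filter_window_eq hS x F hFF (h12 x hx)
    -- abbreviations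
    set r : EuclideanSpace ℝ (Fin 3) → ℝ := ((fun f : EuclideanSpace ℝ (Fin 3) → ℝ => fun x : EuclideanSpace ℝ (Fin 3) =>
            (1 / 12 : ℝ) * ∫ y, (if 0 < dist x y ∧ dist x y ≤ 28 / 25 then f y else 0)
              ∂((MeasureTheory.Measure.count : MeasureTheory.Measure (EuclideanSpace ℝ (Fin 3))).restrict S))^[n] f) with hr
    set G : EuclideanSpace ℝ (Fin 3) → ℝ≥0∞ := ((fun (h : EuclideanSpace ℝ (Fin 3) → ℝ≥0∞) (x : EuclideanSpace ℝ (Fin 3)) =>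
          (12 : ℝ≥0∞)⁻¹ * ∫⁻ y, ((fun y => y - x) ⁻¹'
            {v : EuclideanSpace ℝ (Fin 3) | 0 < dist (0 : EuclideanSpace ℝ (Fin 3)) v ∧
              dist (0 : EuclideanSpace ℝ (Fin 3)) v ≤ 28 / 25}).indicator h y
            ∂((MeasureTheory.Measure.count : MeasureTheory.Measure (EuclideanSpace ℝ (Fin 3))).restrict S))^[n] g) with hG
    have ihF : ∀ y ∈ F, G y = ENNReal.ofReal (r y + M) ∧ |r y| ≤ M := fun y hy => ih y (hFS y hy)
    rw [Function.iterate_succ_apply', Function.iterate_succ_apply']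
    rw [← hG, ← hr]
    rw [walk_lintegral_eq_sum hS G x F hFF, walk_integral_eq_sum' r x F hFF]
    -- the real window sum and its bound
    have hsumM : ∑ y ∈ F, (if 0 < dist x y ∧ dist x y ≤ 28 / 25 then (M : ℝ) else 0) = 12 * M := by
      rw [← Finset.sum_filter, Finset.sum_const, hcard, nsmul_eq_mul]; norm_num
    have habs : |∑ y ∈ F, (if 0 < dist x y ∧ dist x y ≤ 28 / 25 then r y else 0)| ≤ 12 * M := by
      rw [← hsumM]
      refine (Finset.abs_sum_le_sum_abs _ _).trans (Finset.sum_le_sum fun y hy => ?_)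
      by_cases hw : 0 < dist x y ∧ dist x y ≤ 28 / 25
      · rw [if_pos hw, if_pos hw]; exact (ihF y hy).2
      · rw [if_neg hw, if_neg hw, abs_zero]
    refine ⟨?_, ?_⟩
    · -- ℝ≥0∞ side
      have hterm : ∀ y ∈ F, (if 0 < dist x y ∧ dist x y ≤ 28 / 25 then G y else 0)
          = ENNReal.ofReal (if 0 < dist x y ∧ dist x y ≤ 28 / 25 then r y + M else 0) := by
        intro y hy
        by_cases hw : 0 < dist x y ∧ dist x y ≤ 28 / 25
        · rw [if_pos hw, if_pos hw, (ihF y hy).1]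
        · rw [if_neg hw, if_neg hw, ENNReal.ofReal_zero]
      have hnn : ∀ y ∈ F, 0 ≤ (if 0 < dist x y ∧ dist x y ≤ 28 / 25 then r y + M else 0) := by
        intro y hy
        by_cases hw : 0 < dist x y ∧ dist x y ≤ 28 / 25
        · rw [if_pos hw]
          have := (ihF y hy).2
          rw [abs_le] at this
          linarith [this.1]
        · rw [if_neg hw]
      rw [Finset.sum_congr rfl hterm, ← ENNReal.ofReal_sum_of_nonneg hnn]
      have h12 : (12 : ℝ≥0∞)⁻¹ = ENNReal.ofReal (1 / 12 : ℝ) := by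
        rw [one_div, ENNReal.ofReal_inv_of_pos (by norm_num : (0:ℝ) < 12)]
        norm_num
      rw [h12, ← ENNReal.ofReal_mul (by norm_num : (0:ℝ) ≤ 1 / 12)]
      congr 1
      have hsplit : ∑ y ∈ F, (if 0 < dist x y ∧ dist x y ≤ 28 / 25 then r y + M else 0)
          = ∑ y ∈ F, (if 0 < dist x y ∧ dist x y ≤ 28 / 25 then r y else 0)
            + ∑ y ∈ F, (if 0 < dist x y ∧ dist x y ≤ 28 / 25 then (M : ℝ) else 0) := by
        rw [← Finset.sum_add_distrib]
        refine Finset.sum_congr rfl fun y _ => ?_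
        split_ifs <;> ring
      rw [hsplit, hsumM]
      ring
    · -- the bound
      rw [abs_mul, abs_of_pos (by norm_num : (0:ℝ) < 1 / 12)]
      have := habs
      linarith

end Summit.AtomisticToContinuum.Crystallization.Theorems.ChartedPlanarOrderEnvelopeTransport
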